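import Literature.Probability.Percolation.KestenZhangPeierls
import HarnessLib

/-!
# QUANT lane / PAPER-2 rate track (ARM-1, gen 3): depth-first codes for counting connected sets — the machine
# (words with `k` pushes, the stack machine, a removable far point, the depth-first family)

builds on p205010 (kernel theorem, internal audit signed; external expert review pending)

Cell `prim-quant`, seat `prim-quant-arm-1` (rate-theorem architect), memo `run/shared/lean/prim/quant/RATE-PLAN.md` §11.6 (i).
First of two files (the second, `…QuantStarAnimalCountDFS`, proves that every connected set is a depth-first trace and derives
`#starAnimals v m ≤ (4·(3^d − 1))^{m−1}`, which moves the exploration-driver threshold of Kozma–Nitzan's Theorem 6 from `2⁻⁸` to `2⁻⁶`).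
The classical spanning-tree (depth-first) encoding: a connected set of `n + 1` vertices through `v` in a graph whose vertices have at
most `Δ` listed neighbours is the set of stack tops of a machine driven by a word of length `2n` over `{push a : a < Δ} ∪ {pop}` with
exactly `n` pushes — at most `binom(2n, n)·Δ^n ≤ (4Δ)^n` words (versus `(Δ+1)^{2n}` closed lazy walks, Friedli–Velenik Lemma 3.38,
`LatticeAnimals.card_connectedFamily_le`).  This file (generic over `nbr : V → Finset V`, namespace `…Quant.DFSCount`):
* `codes Δ len k` — words of length `len` over `Option (Fin Δ)` with exactly `k` letters `some _`; `mem_codes_iff`; the Pascal count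
  `card_codes_le : #codes Δ len k ≤ binom(len, k)·Δ^k`;
* `pick`/`step`/`run`/`headSet`/`visit` — the stack machine (a push moves to the `a`-th listed neighbour of the top, a pop returns; a
  one-element stack is never popped), `visit_append` (compositionality), `exists_prefix_of_mem_visit` (every visited vertex is on top after
  some prefix), `run_push_pop`/`visit_push_pop`, `exists_pick_eq`;
* `ReachN`/`exists_leaf` — chain distance inside a finite set and a REMOVABLE FAR POINT: if `S ∋ x` is connected from `x` by `R`-chains inside
  `S` and `#S ≥ 2`, some `z ≠ x` has an `R`-predecessor in `S ∖ {z}` and `S ∖ {z}` is still connected from `x`;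
* `dfsFamily nbr Δ x n` — the traces `visit w [x]`, `w ∈ codes Δ (2n) n`.
Pure combinatorics, no percolation input. [folklore]
-/

noncomputable section

namespace Summit.CriticalPhenomena.PercolationContinuityZ3.Theorems.Quant.DFSCount

open Finset Relation
open scoped Classical

variable {V : Type*} [DecidableEq V]

/-! ## Words with a prescribed number of pushes -/

/-- `codes Δ len k`: the lists of length `len` over `Option (Fin Δ)` with exactly `k` entries of the form `some _`
(defined by the Pascal recursion on the length).
builds on p205010 (kernel theorem, internal audit signed; external expert review pending). [folklore] -/
def codes (Δ : ℕ) : ℕ → ℕ → Finset (List (Option (Fin Δ)))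
  | 0, 0 => {[]}
  | 0, _ + 1 => ∅
  | len + 1, 0 => (codes Δ len 0).image (List.cons none)
  | len + 1, k + 1 => (codes Δ len (k + 1)).image (List.cons none) ∪
      ((codes Δ len k) ×ˢ (Finset.univ : Finset (Fin Δ))).image fun q => some q.2 :: q.1

/-- Membership in `codes`: length `len` and exactly `k` pushes.
builds on p205010 (kernel theorem, internal audit signed; external expert review pending). [folklore] -/
theorem mem_codes_iff {Δ : ℕ} : ∀ {len k : ℕ} {w : List (Option (Fin Δ))},
    w ∈ codes Δ len k ↔ w.length = len ∧ w.countP (fun o => o.isSome) = k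
  | 0, 0, [] => by simp [codes]
  | 0, 0, o :: t => by simp [codes]
  | 0, k + 1, [] => by simp [codes]
  | 0, k + 1, o :: t => by simp [codes]
  | len + 1, 0, [] => by simp [codes]
  | len + 1, 0, none :: t => by simpa [codes, List.countP_cons] using @mem_codes_iff Δ len 0 t
  | len + 1, 0, some a :: t => by simp [codes]
  | len + 1, k + 1, [] => by simp [codes]
  | len + 1, k + 1, none :: t => by simpa [codes, List.countP_cons] using @mem_codes_iff Δ len (k + 1) t
  | len + 1, k + 1, some a :: t => by simpa [codes, List.countP_cons] using @mem_codes_iff Δ len k t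

/-- **The Pascal count**: `#codes Δ len k ≤ binom(len, k)·Δ^k`.
builds on p205010 (kernel theorem, internal audit signed; external expert review pending). [folklore] -/
theorem card_codes_le (Δ : ℕ) : ∀ len k : ℕ, (codes Δ len k).card ≤ len.choose k * Δ ^ k
  | 0, 0 => by simp [codes]
  | 0, k + 1 => by simp [codes]
  | len + 1, 0 => by
    simp only [codes, Nat.choose_zero_right, pow_zero, mul_one]
    exact card_image_le.trans (by simpa using card_codes_le Δ len 0)
  | len + 1, k + 1 => by
    simp only [codes]
    calc ((codes Δ len (k + 1)).image (List.cons none) ∪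
            ((codes Δ len k ×ˢ (Finset.univ : Finset (Fin Δ))).image fun q => some q.2 :: q.1)).card
        ≤ ((codes Δ len (k + 1)).image (List.cons none)).card +
            (((codes Δ len k ×ˢ (Finset.univ : Finset (Fin Δ))).image fun q => some q.2 :: q.1)).card :=
          card_union_le _ _
      _ ≤ (codes Δ len (k + 1)).card + (codes Δ len k ×ˢ (Finset.univ : Finset (Fin Δ))).card :=
          add_le_add card_image_le card_image_le
      _ = (codes Δ len (k + 1)).card + (codes Δ len k).card * Δ := by
          rw [card_product, card_univ, Fintype.card_fin]
      _ ≤ len.choose (k + 1) * Δ ^ (k + 1) + len.choose k * Δ ^ k * Δ :=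
          add_le_add (card_codes_le Δ len (k + 1)) (Nat.mul_le_mul_right _ (card_codes_le Δ len k))
      _ = (len + 1).choose (k + 1) * Δ ^ (k + 1) := by
          rw [Nat.choose_succ_succ', pow_succ]; ring

/-! ## The stack machine -/

section Machine

variable (nbr : V → Finset V) (Δ : ℕ)

/-- The `a`-th listed neighbour of `x` (default `x` when `a` is out of range).
builds on p205010 (kernel theorem, internal audit signed; external expert review pending). [folklore] -/
def pick (x : V) (a : Fin Δ) : V := (nbr x).toList.getD a.val x

/-- One instruction of the depth-first machine on the stack (top first): `some a` pushes the `a`-th listed neighbour of the top,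
`none` pops (a one-element stack is left alone).
builds on p205010 (kernel theorem, internal audit signed; external expert review pending). [folklore] -/
def step : List V → Option (Fin Δ) → List V
  | [], _ => []
  | u :: st, some a => pick nbr Δ u a :: u :: st
  | [u], none => [u]
  | _ :: v :: st, none => v :: st

/-- The final stack after a word.
builds on p205010 (kernel theorem, internal audit signed; external expert review pending). [folklore] -/
def run (w : List (Option (Fin Δ))) (st : List V) : List V := w.foldl (step nbr Δ) st

/-- The top of a stack, as a set (empty for the empty stack).
builds on p205010 (kernel theorem, internal audit signed; external expert review pending). [folklore] -/
def headSet : List V → Finset V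
  | [] => ∅
  | u :: _ => {u}

/-- The set of stack tops met while running a word from a stack (including the initial top).
builds on p205010 (kernel theorem, internal audit signed; external expert review pending). [folklore] -/
def visit : List (Option (Fin Δ)) → List V → Finset V
  | [], st => headSet st
  | i :: w, st => headSet st ∪ visit w (step nbr Δ st i)

variable {nbr Δ}

omit [DecidableEq V] in
/-- `run` on a cons.
builds on p205010 (kernel theorem, internal audit signed; external expert review pending). [folklore] -/
theorem run_cons (i : Option (Fin Δ)) (w : List (Option (Fin Δ))) (st : List V) :
    run nbr Δ (i :: w) st = run nbr Δ w (step nbr Δ st i) := rfl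

omit [DecidableEq V] in
/-- `run` on an append.
builds on p205010 (kernel theorem, internal audit signed; external expert review pending). [folklore] -/
theorem run_append (w₁ w₂ : List (Option (Fin Δ))) (st : List V) :
    run nbr Δ (w₁ ++ w₂) st = run nbr Δ w₂ (run nbr Δ w₁ st) := by
  simp [run, List.foldl_append]

/-- The initial top is visited.
builds on p205010 (kernel theorem, internal audit signed; external expert review pending). [folklore] -/
theorem headSet_subset_visit (w : List (Option (Fin Δ))) (st : List V) : headSet st ⊆ visit nbr Δ w st := by
  cases w with
  | nil => exact subset_rfl
  | cons i w => exact subset_union_left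

/-- **Compositionality**: the tops met along `w₁ ++ w₂` are those met along `w₁` and those met along `w₂` from the stack `w₁` leaves.
builds on p205010 (kernel theorem, internal audit signed; external expert review pending). [folklore] -/
theorem visit_append (w₁ w₂ : List (Option (Fin Δ))) (st : List V) :
    visit nbr Δ (w₁ ++ w₂) st = visit nbr Δ w₁ st ∪ visit nbr Δ w₂ (run nbr Δ w₁ st) := by
  induction w₁ generalizing st with
  | nil =>
    simp only [List.nil_append, visit, run, List.foldl_nil]
    exact (union_eq_right.2 (headSet_subset_visit w₂ st)).symm
  | cons i w₁ ih =>
    simp only [List.cons_append, visit, run_cons, ih, union_assoc]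

/-- Every visited vertex is the top of the stack after some prefix of the word.
builds on p205010 (kernel theorem, internal audit signed; external expert review pending). [folklore] -/
theorem exists_prefix_of_mem_visit {w : List (Option (Fin Δ))} {st : List V} {v : V} (hv : v ∈ visit nbr Δ w st) :
    ∃ w₁ w₂ : List (Option (Fin Δ)), w = w₁ ++ w₂ ∧ ∃ rest : List V, run nbr Δ w₁ st = v :: rest := by
  induction w generalizing st with
  | nil =>
    cases st with
    | nil => simp [visit, headSet] at hv
    | cons u rest =>
      simp only [visit, headSet, mem_singleton] at hv
      subst hv
      exact ⟨[], [], rfl, rest, rfl⟩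
  | cons i w ih =>
    simp only [visit, mem_union] at hv
    rcases hv with hv | hv
    · cases st with
      | nil => simp [headSet] at hv
      | cons u rest =>
        simp only [headSet, mem_singleton] at hv
        subst hv
        exact ⟨[], i :: w, rfl, rest, rfl⟩
    · obtain ⟨w₁, w₂, rfl, rest, hrun⟩ := ih hv
      exact ⟨i :: w₁, w₂, rfl, rest, by rw [run_cons, hrun]⟩

omit [DecidableEq V] in
/-- Push-then-pop from a nonempty stack returns to it …
builds on p205010 (kernel theorem, internal audit signed; external expert review pending). [folklore] -/
theorem run_push_pop (a : Fin Δ) (u : V) (rest : List V) :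
    run nbr Δ [some a, none] (u :: rest) = u :: rest := by
  simp [run, step]

/-- … having visited the top and its `a`-th listed neighbour.
builds on p205010 (kernel theorem, internal audit signed; external expert review pending). [folklore] -/
theorem visit_push_pop (a : Fin Δ) (u : V) (rest : List V) :
    visit nbr Δ [some a, none] (u :: rest) = {u, pick nbr Δ u a} := by
  simp only [visit, step, headSet]
  ext x; simp [or_comm]

omit [DecidableEq V] in
/-- Every listed neighbour is picked by some letter, when `#nbr x ≤ Δ`.
builds on p205010 (kernel theorem, internal audit signed; external expert review pending). [folklore] -/
theorem exists_pick_eq (hΔ : ∀ x, (nbr x).card ≤ Δ) {x y : V} (hy : y ∈ nbr x) : ∃ a : Fin Δ, pick nbr Δ x a = y := by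
  have hyl : y ∈ (nbr x).toList := Finset.mem_toList.2 hy
  obtain ⟨i, hi, hget⟩ := List.getElem_of_mem hyl
  have hiΔ : i < Δ := lt_of_lt_of_le (by simpa [Finset.length_toList] using hi) (hΔ x)
  refine ⟨⟨i, hiΔ⟩, ?_⟩
  simp only [pick]
  rw [List.getD_eq_getElem _ _ hi, hget]

end Machine

/-! ## Chain distance and a removable far point -/

section Leaf

variable {R : V → V → Prop}

/-- `R`-chains of prescribed length inside `S`.
builds on p205010 (kernel theorem, internal audit signed; external expert review pending). [folklore] -/
def ReachN (R : V → V → Prop) (S : Finset V) (x : V) : ℕ → V → Prop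
  | 0, w => w = x
  | k + 1, w => ∃ u, ReachN R S x k u ∧ R u w ∧ u ∈ S ∧ w ∈ S

omit [DecidableEq V] in
/-- A chain inside `S` (as a `ReflTransGen`) has some length.
builds on p205010 (kernel theorem, internal audit signed; external expert review pending). [folklore] -/
theorem exists_reachN_of_reflTransGen {S : Finset V} {x w : V}
    (h : ReflTransGen (fun a b => R a b ∧ a ∈ S ∧ b ∈ S) x w) : ∃ k, ReachN R S x k w := by
  induction h with
  | refl => exact ⟨0, rfl⟩
  | tail _ hab ih =>
    obtain ⟨k, hk⟩ := ih
    exact ⟨k + 1, _, hk, hab.1, hab.2.1, hab.2.2⟩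

omit [DecidableEq V] in
/-- A chain of length `0` stays put.
builds on p205010 (kernel theorem, internal audit signed; external expert review pending). [folklore] -/
theorem eq_of_reachN_zero {S : Finset V} {x w : V} (h : ReachN R S x 0 w) : w = x := h

omit [DecidableEq V] in
/-- The last step of a chain of positive length.
builds on p205010 (kernel theorem, internal audit signed; external expert review pending). [folklore] -/
theorem exists_pred_of_reachN_succ {S : Finset V} {x w : V} {k : ℕ} (h : ReachN R S x (k + 1) w) :
    ∃ u, ReachN R S x k u ∧ R u w ∧ u ∈ S ∧ w ∈ S := h

/-- **A removable far point.**  If the finite set `S ∋ x` is connected from `x` by `R`-chains inside `S` and has at least two points,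
then some `z ∈ S`, `z ≠ x`, has an `R`-predecessor `z'` in `S ∖ {z}`, and `S ∖ {z}` is still connected from `x` by `R`-chains inside it
(take `z` at maximal chain distance from `x`).
builds on p205010 (kernel theorem, internal audit signed; external expert review pending). [folklore] -/
theorem exists_leaf {S : Finset V} {x : V} (hx : x ∈ S)
    (hconn : ∀ w ∈ S, ReflTransGen (fun a b => R a b ∧ a ∈ S ∧ b ∈ S) x w) (h2 : 2 ≤ S.card) :
    ∃ z ∈ S, z ≠ x ∧ (∃ z' ∈ S.erase z, R z' z) ∧
      ∀ w ∈ S.erase z, ReflTransGen (fun a b => R a b ∧ a ∈ S.erase z ∧ b ∈ S.erase z) x w := by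
  -- chain distance from `x` inside `S`
  have hex : ∀ w ∈ S, ∃ k, ReachN R S x k w := fun w hw => exists_reachN_of_reflTransGen (hconn w hw)
  let dist : V → ℕ := fun w => if hw : w ∈ S then Nat.find (hex w hw) else 0
  have hdist_spec : ∀ w (hw : w ∈ S), ReachN R S x (dist w) w := by
    intro w hw
    simp only [dist, dif_pos hw]
    exact Nat.find_spec (hex w hw)
  have hdist_min : ∀ w (hw : w ∈ S) k, ReachN R S x k w → dist w ≤ k := by
    intro w hw k hk
    simp only [dist, dif_pos hw]
    exact Nat.find_min' _ hk
  -- predecessor structure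
  have hpred : ∀ w ∈ S, ∀ k, dist w = k + 1 → ∃ u ∈ S, R u w ∧ dist u ≤ k := by
    intro w hw k hk
    have h := hdist_spec w hw
    rw [hk] at h
    obtain ⟨u, hu, huw, huS, -⟩ := exists_pred_of_reachN_succ h
    exact ⟨u, huS, huw, hdist_min u huS k hu⟩
  have hdist_x : dist x = 0 := Nat.le_zero.1 (hdist_min x hx 0 (show ReachN R S x 0 x from rfl))
  have hdist_pos : ∀ w ∈ S, w ≠ x → 0 < dist w := by
    intro w hw hwx
    by_contra h0
    push Not at h0
    have h := hdist_spec w hw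
    rw [Nat.le_zero.1 h0] at h
    exact hwx (eq_of_reachN_zero h)
  -- a farthest point
  obtain ⟨z, hzS, hzmax⟩ := exists_max_image S dist ⟨x, hx⟩
  -- there is a second point, so `z ≠ x`
  have hzx : z ≠ x := by
    obtain ⟨w, hwS, hwx⟩ : ∃ w ∈ S, w ≠ x := by
      by_contra hc
      push Not at hc
      have : S ⊆ {x} := fun w hw => mem_singleton.2 (hc w hw)
      have := card_le_card this
      rw [card_singleton] at this
      omega
    intro hzx'
    have h1 := hzmax w hwS
    rw [hzx', hdist_x] at h1
    exact absurd (hdist_pos w hwS hwx) (by omega)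
  refine ⟨z, hzS, hzx, ?_, ?_⟩
  · -- predecessor of `z`
    obtain ⟨k, hk⟩ : ∃ k, dist z = k + 1 := Nat.exists_eq_succ_of_ne_zero (hdist_pos z hzS hzx).ne'
    obtain ⟨u, huS, huz, hdu⟩ := hpred z hzS k hk
    refine ⟨u, mem_erase.2 ⟨fun h => ?_, huS⟩, huz⟩
    rw [h, hk] at hdu
    omega
  · -- connectivity of `S.erase z` from `x`, by induction on the distance
    have key : ∀ k, ∀ w ∈ S, dist w ≤ k → w ≠ z →
        ReflTransGen (fun a b => R a b ∧ a ∈ S.erase z ∧ b ∈ S.erase z) x w := by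
      intro k
      induction k with
      | zero =>
        intro w hw hdw _
        have h := hdist_spec w hw
        rw [Nat.le_zero.1 hdw] at h
        rw [eq_of_reachN_zero h]
      | succ k ih =>
        intro w hw hdw hwz
        rcases Nat.lt_or_ge (dist w) (k + 1) with hlt | hge
        · exact ih w hw (by omega) hwz
        · have hdk : dist w = k + 1 := le_antisymm hdw hge
          obtain ⟨u, huS, huw, hdu⟩ := hpred w hw k hdk
          have huz : u ≠ z := by
            intro h
            rw [h] at hdu
            have := hzmax w hw
            omega
          exact ReflTransGen.tail (ih u huS hdu huz)
            ⟨huw, mem_erase.2 ⟨huz, huS⟩, mem_erase.2 ⟨hwz, hw⟩⟩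
    intro w hw
    obtain ⟨hwz, hwS⟩ := mem_erase.1 hw
    exact key (dist w) w hwS le_rfl hwz

end Leaf

/-! ## The depth-first family -/

section Family

variable (nbr : V → Finset V) (Δ : ℕ)

/-- The depth-first family at `x` of size parameter `n`: the traces `visit w [x]` of the words with `n` pushes and `n` pops.
builds on p205010 (kernel theorem, internal audit signed; external expert review pending). [folklore] -/
def dfsFamily (x : V) (n : ℕ) : Finset (Finset V) := (codes Δ (2 * n) n).image fun w => visit nbr Δ w [x]

end Family

end Summit.CriticalPhenomena.PercolationContinuityZ3.Theorems.Quant.DFSCount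

end
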